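import Summits.KontsevichZagierPeriods.KontsevichZagierPeriods.Theses.MotivatedMoves
import Literature.NumberTheory.Transcendental.KZRulesAssociator
import Literature.NumberTheory.Transcendental.KZGroundingRelations

/-!
# `ConstantMatrixUnit` (stmt-KontsevichZagierPeriods-3745, route MotivatedMoves) — proof

Let `ainv * a = 1` in `Mat_d(ℝ)` and let `R`, `Rinv` be matrices of 0-dimensional constant
representations, `R l j = [pt, a l j]`, `Rinv i l = [pt, ainv i l]` (domain `univ ⊆ ℝ⁰`, constant
integrands). Then for every formal combination `x`,
`∑ l, [Rinv i l] * ([R l j] * x) - δ_{ij} x ∈ KZ.relations`.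

Proof: pass to the formal period ring `P = FormalRep ⧸ relations`, an honest commutative ring
(`KZ.FormalPeriodRing`, quotient map `KZ.toFormalPeriod : FormalRep →ₙ+* P` with
`toFormalPeriod_eq_zero_iff : ⟦c⟧ = 0 ↔ c ∈ relations`). There the claim reads
`(∑ l, ⟦Rinv i l⟧ ⟦R l j⟧) ⟦x⟧ = δ_{ij} ⟦x⟧`, and `⟦Rinv i l⟧ ⟦R l j⟧ = ⟦(Rinv i l).prod (R l j)⟧`
is the class of the point representation with constant integrand `ainv i l * a l j`
(`IntegralRep.prod_integrand_eq`). By iterated additivity of the integrand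
(`KZ.of_sub_sum_integrand_mem_relations`) the sum over `l` is the class of the point
representation with integrand `∑ l, ainv i l * a l j = (ainv * a) i j = δ_{ij}`, i.e. of `[pt, 1]`
(class `1`, `toFormalPeriod_of_unit`) if `i = j` and of a zero representation (class `0`,
`KZ.of_mem_relations_of_eqOn_zero`) otherwise. No algebraicity of the entries of `a`, `ainv` is
used. Landed by lead c10 of crux stmt-KontsevichZagierPeriods-9129 (banking). No definitions.
-/

namespace Summit.KontsevichZagierPeriods.MotivatedMoves

open Set
open Literature.NumberTheory.Transcendental
open Literature.NumberTheory.Transcendental.KZ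

/-- **`ConstantMatrixUnit`** (route MotivatedMoves, stmt-KontsevichZagierPeriods-3745): for real
matrices with `ainv * a = 1` and matrices `R`, `Rinv` of constant point representations
`[pt, a l j]`, `[pt, ainv i l]`, one has `∑ l, [Rinv i l] * ([R l j] * x) - δ_{ij} x ∈ KZ.relations`
for every `x : KZ.FormalRep`. Computed in the commutative formal period ring
`KZ.FormalPeriodRing`: `∑ l, ⟦Rinv i l⟧ ⟦R l j⟧ = ⟦[pt, ∑ l, ainv i l * a l j]⟧ = ⟦[pt, δ_{ij}]⟧ = δ_{ij}`
(product of point representations, iterated integrand additivity, `Matrix.mul_apply`).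
[folklore] -/
theorem constantMatrixUnit_proof :
    Summit.KontsevichZagierPeriods.KontsevichZagierPeriods.Theses.MotivatedMoves.ConstantMatrixUnit := by
  intro d a ainv hinv R Rinv hR hRinv i j x
  -- the point representations `[pt, ainv i l] · [pt, a l j]`
  have hdom : ∀ l, ((Rinv i l).prod (R l j)).domain = univ := fun l =>
    Set.eq_univ_of_forall fun z => (IntegralRep.mem_prodDomain _ _ z).mpr
      ⟨by rw [(hRinv i l).1]; exact mem_univ _, by rw [(hR l j).1]; exact mem_univ _⟩
  have hint : ∀ l z, ((Rinv i l).prod (R l j)).integrand z = ainv i l * a l j := fun l z => by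
    rw [IntegralRep.prod_integrand_eq, IntegralRep.prodFun_apply, (hR l j).2, (hRinv i l).2]
  -- `∑ l, ⟦Rinv i l⟧ ⟦R l j⟧` is the class of any point representation with integrand `δ_{ij}`
  have key : ∀ r₀ : IntegralRep (0 + 0), r₀.domain = univ →
      (r₀.integrand = fun _ => if i = j then 1 else 0) →
      ∑ l, toFormalPeriod (of (Rinv i l)) * toFormalPeriod (of (R l j)) = toFormalPeriod (of r₀) := by
    intro r₀ h₀d h₀i
    simp_rw [toFormalPeriod_of_mul_of]
    rw [← map_sum, eq_comm, toFormalPeriod_eq_iff]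
    refine of_sub_sum_integrand_mem_relations Finset.univ (fun l => (Rinv i l).prod (R l j)) r₀
      (fun l _ => (hdom l).trans h₀d.symm) fun z _ => ?_
    simp only [hint, h₀i, ← Matrix.mul_apply, hinv, Matrix.one_apply]
  -- such a point representation, with class `δ_{ij}` in `P`
  obtain ⟨r₀, h₀d, h₀i, h₀T⟩ : ∃ r₀ : IntegralRep (0 + 0), r₀.domain = univ ∧
      (r₀.integrand = fun _ => if i = j then 1 else 0) ∧
      toFormalPeriod (of r₀) = if i = j then 1 else 0 := by
    by_cases hij : i = j
    · refine ⟨IntegralRep.unit, rfl, ?_, ?_⟩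
      · rw [if_pos hij]; rfl
      · rw [if_pos hij]; rfl
    · obtain ⟨z, hzd, hzi⟩ := exists_zeroRep (n := 0 + 0)
        (Literature.ModelTheory.ExponentialFields.isSemialgebraic_univ (k := ℚ))
      refine ⟨z, hzd, ?_, ?_⟩
      · rw [if_neg hij, hzi]; rfl
      · rw [if_neg hij, toFormalPeriod_eq_zero_iff]
        exact of_mem_relations_of_eqOn_zero z fun w _ => by rw [hzi]
  -- assemble in `P`
  rw [← toFormalPeriod_eq_zero_iff, map_sub, map_sum]
  have hassoc : ∀ l, toFormalPeriod (of (Rinv i l) * (of (R l j) * x)) =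
      toFormalPeriod (of (Rinv i l)) * toFormalPeriod (of (R l j)) * toFormalPeriod x := fun l => by
    rw [map_mul, map_mul, mul_assoc]
  simp_rw [hassoc]
  rw [← Finset.sum_mul, key r₀ h₀d h₀i, h₀T]
  split_ifs <;> simp

end Summit.KontsevichZagierPeriods.MotivatedMoves
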